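import Summits.QuantumFields.BalabanUV.Beta.EriceRemainderEnclosureHistoryAutonomyComparisonDualChainCriterion
import Summits.QuantumFields.BalabanUV.Beta.EriceRemainderEnclosureHistoryAutonomyComparisonTowerChainFour

/-!
# EriceRemainderEnclosureHistoryAutonomyComparisonTowerFour — (E66c) EVERY FINITE SET OF AGES WITH PAIRWISE RATIOS `≥ 4` COMPARES AT ANY SIZE, WHATEVER ITS
# CARDINALITY: `B(u) = b + Σ_{k<K} L_k·u_k` on ]0,γ] (`b > 0`, `L ≥ 0` supported on `{0} ∪ A`, `A ⊆ [1,K[` with `4·k ≤ k′` for `k < k′` in `A` — `#A`, the sizes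
# AND the Markov weight `L_0` ARBITRARY); `B′ ≥ B` with a zeroth moment and an ISOTONE excess ⟹ ANY box solutions from one pin satisfy `h′ ≤ h` at EVERY
# scale.  (E65f) with the chain of (E66b) (hyperbolic invariant `λ = 4Z∕(2 − Z)`); (E65j): `6`, (E65h): `10`, (E64h): `14`

Cell `pub-balaban`, β-function sub-cell, BINDER row D4 «RemainderConst leaves for Bałaban's split» (`HOME/BINDER-OWNERS.md`; owner lineage `b2b-balaban-beta-an4`;
this file by co-owner #2 lineage `b2b-balaban-beta-d4-p2`, generation 59), β-FLOW TEAM duty (1), FREEZE (0) honoured (def-free; (E65f)'s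
`le_of_isotone_excess_of_budgeted_dual_chain`, (E66b)'s `dual_chain_of_tower_four`, (E65b)'s `le_of_isotone_excess_budgeted_certificate` BY NAME; nothing restated).

HONEST FRAMING (page 1, verbatim and binding).  *"Discharging BetaPertH makes Bałaban's UV stability UNCONDITIONAL — a real constructive-QFT result; it is
NOT the continuum limit and NOT the Clay problem."*  THIS FILE DISCHARGES NOTHING OF THE KIND.  Elementary real analysis about ABSTRACT affine functionals on a
box ]0,γ]^ℕ with displayed supports and signs — hypotheses of a census, not facts; the form, signs, ages and moments of Bałaban's (1.22) limit functional are
NOT PRINTED ([I] p. 298; GAPS G-t4-U2-1∕-2) and NOT asserted.  Row D4 class UNCHANGED (critical-path width 0; instance 0∕1; D4 DISCHARGE NO DATE).  HONEST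
DEPENDENCY: continuum YM on T⁴ ⇐ BetaPertH ∧ nine spine estimates (0/9 proved); BetaPertH ⇐ (D1) ∧ (D4) ∧ CAP+tail; G-an2-4 gates asym, D1 and NE2/3/4.

THE POINT (census sense (α); the COMPARISON column, conjecture (E58′)).  As (E65j), with (E66b)'s hyperbolic invariant in place of the linear one: the
window budget exactly as (E65f) offers it closes the dual chain on every tower of consecutive ratio `≥ 4`.  The ladder of this column: `14` (E64h, slack
system) → `10` (E65h, linear invariant, crude weights) → `6` (E65j, telescoped weights) → `4` (this file, hyperbolic invariant + lattice constants).  NOT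
CLAIMED: ratios below `4` (numerically the LP has room down to ratio `2`; the `(λ, Z)` relaxation itself stops between `3` and `4` — README); anything printed.

WHAT IS PROVED ([folklore]; 0 `def`, 0 sorry).  **`le_of_isotone_excess_ages_ratio_four`** (END, Finset form).
-/
noncomputable section
open Finset Set

namespace Summit.QuantumFields.BalabanUV.Beta.EriceRemainderEnclosureHistoryAutonomyComparisonTowerFour

open Literature.MathematicalPhysics.QuantumFieldTheory.Balaban1983to89
open Literature.MathematicalPhysics.QuantumFieldTheory.Balaban1983to89.T4BetaStationary
open Literature.MathematicalPhysics.QuantumFieldTheory.Balaban1983to89.T4BetaFlowWellPosed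
open Summit.QuantumFields.BalabanUV.Beta.EriceRemainderEnclosureHistoryAutonomyComparisonBudgetedCriterion (le_of_isotone_excess_budgeted_certificate)
open Summit.QuantumFields.BalabanUV.Beta.EriceRemainderEnclosureHistoryAutonomyComparisonDualChainCriterion (le_of_isotone_excess_of_budgeted_dual_chain)
open Summit.QuantumFields.BalabanUV.Beta.EriceRemainderEnclosureHistoryAutonomyComparisonTowerChainFour (dual_chain_of_tower_four)

variable {B' : (ℕ → ℝ) → ℝ} {M' γ b : ℝ} {L : ℕ → ℝ} {K : ℕ} {A : Finset ℕ} {h h' : ℕ → ℝ}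

/-! ## END: towers of ratio `≥ 4`, any height, any sizes -/

/-- **EVERY FINITE SET OF AGES WITH PAIRWISE RATIOS `≥ 4` COMPARES AT ANY SIZE, WHATEVER ITS CARDINALITY.**  `B(u) = b + Σ_{k<K} L_k·u_k` on ]0,γ] with `b > 0`,
`L ≥ 0` supported on `{0} ∪ A`, `A ⊆ [1, K[` with **`4·k ≤ k′` for `k < k′` in `A`** — `#A`, the sizes `L_k` AND the Markov weight `L_0` ARBITRARY; `B′` with
zeroth moment `M′ ≥ 0`, `B ≤ B′`, ISOTONE excess; `h`, `h′` ANY box solutions from one pin `p ∈ ]0,γ]`.  Then `h′ ≤ h` at EVERY scale ((E65f) with the chain of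
(E66b); (E65j): `6`, (E65h): `10`, (E64h): `14`). [folklore] -/
theorem le_of_isotone_excess_ages_ratio_four {p : ℝ} (hL : ∀ k, 0 ≤ L k) (hb : 0 < b) (hAK : A ⊆ range K) (hA1 : ∀ k ∈ A, 1 ≤ k)
    (hsupp : ∀ k ∈ range K, k ∉ A → k ≠ 0 → L k = 0) (hsep : ∀ k ∈ A, ∀ k' ∈ A, k < k' → 4 * k ≤ k')
    (hB' : ∀ u u' : ℕ → ℝ, SeqBox γ u → SeqBox γ u' → ∀ D : ℝ, (∀ j, |u j - u' j| ≤ D) → |B' u - B' u'| ≤ M' * D) (hM' : 0 ≤ M')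
    (hexc : ∀ u, SeqBox γ u → (fun u : ℕ → ℝ => b + ∑ k ∈ range K, L k * u k) u ≤ B' u)
    (hDmono : ∀ u v : ℕ → ℝ, SeqBox γ u → SeqBox γ v → (∀ j, u j ≤ v j) →
      B' u - (fun u : ℕ → ℝ => b + ∑ k ∈ range K, L k * u k) u ≤ B' v - (fun u : ℕ → ℝ => b + ∑ k ∈ range K, L k * u k) v)
    (hp : 0 < p) (hpγ : p ≤ γ) (hh : SeqBox γ h) (hf : MemFlow (fun u : ℕ → ℝ => b + ∑ k ∈ range K, L k * u k) p h)
    (hh' : SeqBox γ h') (hf' : MemFlow B' p h') (j : ℕ) : h' j ≤ h j := by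
  classical
  rcases A.eq_empty_or_nonempty with hA | hA
  · -- no age: the empty certificate
    subst hA
    exact le_of_isotone_excess_budgeted_certificate hL hb hAK hA1 hsupp
      (fun x _ _ _ => ⟨fun _ => 0, fun _ h => absurd h (Finset.notMem_empty _), fun _ h => absurd h (Finset.notMem_empty _), by simp⟩)
      hB' hM' hexc hDmono hp hpγ hh hf hh' hf' j
  · -- the enumeration of A: minimum and predecessor map
    set m₀ := A.min' hA with hm₀_def
    have hm₀ : m₀ ∈ A := min'_mem A hA
    have hmin : ∀ k ∈ A, m₀ ≤ k := fun k hk => min'_le A k hk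
    set pred : ℕ → ℕ := fun k => if hne : (A.filter (fun s => s < k)).Nonempty then (A.filter (fun s => s < k)).max' hne else 0
      with hpred_def
    have hpred : ∀ k ∈ A, k ≠ m₀ → pred k ∈ A ∧ pred k < k ∧ ∀ k'' ∈ A, k'' < k → k'' ≤ pred k := by
      intro k hk hkm
      have hlt : m₀ < k := lt_of_le_of_ne (hmin k hk) (Ne.symm hkm)
      have hne : (A.filter (fun s => s < k)).Nonempty := ⟨m₀, mem_filter.mpr ⟨hm₀, hlt⟩⟩
      have hpk : pred k = (A.filter (fun s => s < k)).max' hne := by simp only [hpred_def, dif_pos hne]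
      have hmem := max'_mem _ hne
      rw [← hpk] at hmem
      refine ⟨(mem_filter.mp hmem).1, (mem_filter.mp hmem).2, fun k'' hk'' hlt'' => ?_⟩
      rw [hpk]; exact le_max' _ _ (mem_filter.mpr ⟨hk'', hlt''⟩)
    have hfour : ∀ k ∈ A, k ≠ m₀ → 4 * pred k ≤ k := fun k hk hkm => by
      obtain ⟨hpA, hplt, _⟩ := hpred k hk hkm
      exact hsep _ hpA _ hk hplt
    refine le_of_isotone_excess_of_budgeted_dual_chain hL hb hAK hA1 hsupp hm₀ hmin hpred (fun x hx _ hbud => ?_)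
      hB' hM' hexc hDmono hp hpγ hh hf hh' hf' j
    exact dual_chain_of_tower_four hA1 hx hm₀ hmin hpred hfour (fun k hk => hbud k (hA1 k hk))

end Summit.QuantumFields.BalabanUV.Beta.EriceRemainderEnclosureHistoryAutonomyComparisonTowerFour

end
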